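import Mathlib
import HarnessLib

/-!
# LINE (A) `product_plus_one` — one-riser interaction lemma, REDUCTION FOR A GENERAL PULL

Crux item stmt-ValiantsHypothesis-18050, LINE (A) floor structure (memo `pub/val-lit/lmr/NOTE-p7g15-18050-LINEA-incoherent-cell.md` §10(d)).
The one-riser lemma ✓ `…OneRiserSeparation.oneRiser_no_four_zeros` treats a cloud of BINOMIAL pullers, whose total pull is `Pl = p·Y·S₁(Y)`.  This file
isolates the part of the argument that does not care what the pull is.  Data: exponents `p = e₁+1 < q = e₁+e₂+2`, a riser `a − b x^p − c x^q`
(`b, c > 0`, bottom letter `a` free) SWITCHED on `[x₁, x₄] ⊂ (0, ∞)`, and ANY positive differentiable "pull" `Pl` there (for a cloud of unswitched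
factors, `Pl = −Σ_i Φ_i`).  With `P = p b x^p + q c x^q`, `w = q c x^q/P` and the DISCRIMINANT

  `D(x) = Pl(x) + x·Pl′(x)/Pl(x) − p − (q − p)·w(x)`,

* `riser_alpha_hasDerivAt` — the separated bottom coefficient `α = b x^p + c x^q − P/Pl` has `α′ = (P/(xPl))·D`;
* ★ `oneRiser_no_four_zeros_of_pull` — if `D` does not vanish at three points `y₁ < y₂ < y₃` of `(x₁, x₄)`, the total Euler ratio
  `P/(b x^p + c x^q − a) − Pl` does not vanish at four points `x₁ < x₂ < x₃ < x₄` (a-separation + Rolle ×3).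

So every cloud shape reduces to ONE real-variable statement «`D` has at most two zeros on the interval»: binomial clouds — proved
(`D = p·YΨ(Y)·… − (q−p)`, ✓ `strictMonoOn_Dhat`); unswitched TRINOMIAL clouds — open, numerically 0 or 2 zeros in ≈ 3 500 exact-checked clouds while
`log(Pl + xPl′/Pl − p)` is NOT convex (memo §10(c)); T1 risers — same `D` with the riser's `w`.  Honest framing: a reduction, not a count; NOT
`OneChangeFloorK3` / `stub_classRowK3` / `stub_polyLaw` / `MatrixDescartes` / B; `VP ≠ VNP` NOT proved.  No definitions, no named facts; Mathlib only.
-/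

set_option linter.dupNamespace false

namespace Summit.ValiantsHypothesis.ValiantsHypothesis.Theorems.LacunarySymmetroidMatrixDescartes

namespace ProductPlusOne

/-- **`α′ = (P/(xPl))·D`.**  For `x > 0`, `Pl(x) ≠ 0` with derivative `Pl′(x)`: the separated bottom coefficient
`α(t) = b t^p + c t^q − (p b t^p + q c t^q)/Pl(t)` has derivative `(P(x)/(x Pl(x)))·(Pl + xPl′/Pl − p − (q−p)·(q c x^q/P))` at `x`
(`p = e₁+1`, `q = e₁+e₂+2`, `P = p b x^p + q c x^q > 0` needs `b, c > 0`). -/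
theorem riser_alpha_hasDerivAt (e₁ e₂ : ℕ) {b c : ℝ} (hb : 0 < b) (hc : 0 < c) (Pl : ℝ → ℝ) {Pl' x : ℝ} (hx : 0 < x)
    (hPl : Pl x ≠ 0) (hder : HasDerivAt Pl Pl' x) :
    HasDerivAt (fun t : ℝ => b * t ^ (e₁ + 1) + c * t ^ (e₁ + e₂ + 2)
        - (((e₁ : ℝ) + 1) * b * t ^ (e₁ + 1) + ((e₁ : ℝ) + e₂ + 2) * c * t ^ (e₁ + e₂ + 2)) / Pl t)
      (((((e₁ : ℝ) + 1) * b * x ^ (e₁ + 1) + ((e₁ : ℝ) + e₂ + 2) * c * x ^ (e₁ + e₂ + 2)) / (x * Pl x))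
        * (Pl x + x * Pl' / Pl x - ((e₁ : ℝ) + 1)
            - ((e₂ : ℝ) + 1) * ((((e₁ : ℝ) + e₂ + 2) * c * x ^ (e₁ + e₂ + 2))
                / (((e₁ : ℝ) + 1) * b * x ^ (e₁ + 1) + ((e₁ : ℝ) + e₂ + 2) * c * x ^ (e₁ + e₂ + 2))))) x := by
  have hxne : x ≠ 0 := hx.ne'
  have hp1 : HasDerivAt (fun t : ℝ => t ^ (e₁ + 1)) (((e₁ + 1 : ℕ) : ℝ) * x ^ e₁) x := by
    simpa using hasDerivAt_pow (e₁ + 1) x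
  have hp2 : HasDerivAt (fun t : ℝ => t ^ (e₁ + e₂ + 2)) (((e₁ + e₂ + 2 : ℕ) : ℝ) * x ^ (e₁ + e₂ + 1)) x := by
    simpa using hasDerivAt_pow (e₁ + e₂ + 2) x
  have hU : HasDerivAt (fun t : ℝ => b * t ^ (e₁ + 1) + c * t ^ (e₁ + e₂ + 2))
      (b * (((e₁ + 1 : ℕ) : ℝ) * x ^ e₁) + c * (((e₁ + e₂ + 2 : ℕ) : ℝ) * x ^ (e₁ + e₂ + 1))) x :=
    (hp1.const_mul b).add (hp2.const_mul c)
  have hP : HasDerivAt (fun t : ℝ => ((e₁ : ℝ) + 1) * b * t ^ (e₁ + 1) + ((e₁ : ℝ) + e₂ + 2) * c * t ^ (e₁ + e₂ + 2))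
      (((e₁ : ℝ) + 1) * b * (((e₁ + 1 : ℕ) : ℝ) * x ^ e₁)
        + ((e₁ : ℝ) + e₂ + 2) * c * (((e₁ + e₂ + 2 : ℕ) : ℝ) * x ^ (e₁ + e₂ + 1))) x :=
    (hp1.const_mul (((e₁ : ℝ) + 1) * b)).add (hp2.const_mul (((e₁ : ℝ) + e₂ + 2) * c))
  have hall := hU.sub (hP.div hder hPl)
  refine hall.congr_deriv ?_
  have hPpos : 0 < ((e₁ : ℝ) + 1) * b * x ^ (e₁ + 1) + ((e₁ : ℝ) + e₂ + 2) * c * x ^ (e₁ + e₂ + 2) := by positivity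
  have hPne := hPpos.ne'
  -- normalise `x ^ e₁ = x ^ (e₁+1) / x` etc. by clearing denominators
  have hx1 : x ^ (e₁ + 1) = x ^ e₁ * x := pow_succ x e₁
  have hx2 : x ^ (e₁ + e₂ + 2) = x ^ (e₁ + e₂ + 1) * x := pow_succ x (e₁ + e₂ + 1)
  push_cast
  field_simp
  rw [hx1, hx2]
  ring

/-- ★ **ONE RISER AGAINST A GENERAL PULL: four zeros force three zeros of the discriminant.**  Riser `a − b x^p − c x^q` (`b, c > 0`)
switched on `[x₁, x₄] ⊂ (0,∞)` (`a < b x^p + c x^q` there); pull `Pl > 0` with derivative `Pl′` on the interval.  If the discriminant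
`D(y) = Pl + yPl′/Pl − p − (q−p)·q c y^q/(p b y^p + q c y^q)` has NO three zeros `x₁ < y₁ < y₂ < y₃ < x₄`, then the total Euler ratio
`P/(b x^p + c x^q − a) − Pl` does not vanish at four points `x₁ < x₂ < x₃ < x₄`. [this file's theorem] -/
theorem oneRiser_no_four_zeros_of_pull (e₁ e₂ : ℕ) {a b c : ℝ} (hb : 0 < b) (hc : 0 < c) (Pl Pl' : ℝ → ℝ)
    {x₁ x₂ x₃ x₄ : ℝ} (h0 : 0 < x₁) (h12 : x₁ < x₂) (h23 : x₂ < x₃) (h34 : x₃ < x₄)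
    (hsw : ∀ x ∈ Set.Icc x₁ x₄, a < b * x ^ (e₁ + 1) + c * x ^ (e₁ + e₂ + 2))
    (hPlpos : ∀ x ∈ Set.Icc x₁ x₄, 0 < Pl x) (hPlder : ∀ x ∈ Set.Icc x₁ x₄, HasDerivAt Pl (Pl' x) x)
    (hD : ∀ y₁ y₂ y₃ : ℝ, x₁ < y₁ → y₁ < y₂ → y₂ < y₃ → y₃ < x₄ →
      Pl y₁ + y₁ * Pl' y₁ / Pl y₁ - ((e₁ : ℝ) + 1) - ((e₂ : ℝ) + 1) * ((((e₁ : ℝ) + e₂ + 2) * c * y₁ ^ (e₁ + e₂ + 2))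
          / (((e₁ : ℝ) + 1) * b * y₁ ^ (e₁ + 1) + ((e₁ : ℝ) + e₂ + 2) * c * y₁ ^ (e₁ + e₂ + 2))) = 0 →
      Pl y₂ + y₂ * Pl' y₂ / Pl y₂ - ((e₁ : ℝ) + 1) - ((e₂ : ℝ) + 1) * ((((e₁ : ℝ) + e₂ + 2) * c * y₂ ^ (e₁ + e₂ + 2))
          / (((e₁ : ℝ) + 1) * b * y₂ ^ (e₁ + 1) + ((e₁ : ℝ) + e₂ + 2) * c * y₂ ^ (e₁ + e₂ + 2))) = 0 →
      Pl y₃ + y₃ * Pl' y₃ / Pl y₃ - ((e₁ : ℝ) + 1) - ((e₂ : ℝ) + 1) * ((((e₁ : ℝ) + e₂ + 2) * c * y₃ ^ (e₁ + e₂ + 2))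
          / (((e₁ : ℝ) + 1) * b * y₃ ^ (e₁ + 1) + ((e₁ : ℝ) + e₂ + 2) * c * y₃ ^ (e₁ + e₂ + 2))) = 0 → False)
    (hzero : ∀ x ∈ ({x₁, x₂, x₃, x₄} : Set ℝ),
      (((e₁ : ℝ) + 1) * b * x ^ (e₁ + 1) + ((e₁ : ℝ) + e₂ + 2) * c * x ^ (e₁ + e₂ + 2))
          / (b * x ^ (e₁ + 1) + c * x ^ (e₁ + e₂ + 2) - a) - Pl x = 0) : False := by
  set pR : ℝ := (e₁ : ℝ) + 1 with hpR
  set qR : ℝ := (e₁ : ℝ) + e₂ + 2 with hqR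
  -- the separated bottom coefficient, its derivative factor and the discriminant
  set α : ℝ → ℝ := fun t => b * t ^ (e₁ + 1) + c * t ^ (e₁ + e₂ + 2)
      - (pR * b * t ^ (e₁ + 1) + qR * c * t ^ (e₁ + e₂ + 2)) / Pl t with hαdef
  set gα : ℝ → ℝ := fun t => (pR * b * t ^ (e₁ + 1) + qR * c * t ^ (e₁ + e₂ + 2)) / (t * Pl t) with hgα
  set D : ℝ → ℝ := fun t => Pl t + t * Pl' t / Pl t - pR
      - ((e₂ : ℝ) + 1) * ((qR * c * t ^ (e₁ + e₂ + 2)) / (pR * b * t ^ (e₁ + 1) + qR * c * t ^ (e₁ + e₂ + 2))) with hDdef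
  -- (1) at a zero of the total ratio, `α = a`
  have hαa : ∀ x ∈ Set.Icc x₁ x₄,
      (pR * b * x ^ (e₁ + 1) + qR * c * x ^ (e₁ + e₂ + 2)) / (b * x ^ (e₁ + 1) + c * x ^ (e₁ + e₂ + 2) - a) - Pl x = 0 →
        α x = a := by
    intro x hx hz
    have hx0 : 0 < x := h0.trans_le hx.1
    have hh : 0 < b * x ^ (e₁ + 1) + c * x ^ (e₁ + e₂ + 2) - a := by linarith [hsw x hx]
    have hN := hPlpos x hx
    have hpR0 : 0 < pR := by rw [hpR]; positivity
    have hqR0 : 0 < qR := by rw [hqR]; positivity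
    have e1 : pR * b * x ^ (e₁ + 1) + qR * c * x ^ (e₁ + e₂ + 2) = Pl x * (b * x ^ (e₁ + 1) + c * x ^ (e₁ + e₂ + 2) - a) := by
      have := sub_eq_zero.1 hz
      field_simp at this
      linarith
    simp only [hαdef]
    rw [e1]
    field_simp
    ring
  -- (2) `α′ = gα · D` on the interval, `gα > 0`
  have hderα : ∀ x ∈ Set.Icc x₁ x₄, ∃ f' : ℝ, HasDerivAt α f' x ∧ f' = gα x * D x := by
    intro x hx
    have hx0 : 0 < x := h0.trans_le hx.1
    refine ⟨_, ?_, rfl⟩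
    have h := riser_alpha_hasDerivAt e₁ e₂ hb hc Pl hx0 (hPlpos x hx).ne' (hPlder x hx)
    simp only [hαdef, hgα, hDdef, hpR, hqR]
    exact h
  have hgαpos : ∀ x ∈ Set.Icc x₁ x₄, 0 < gα x := by
    intro x hx
    have hx0 : 0 < x := h0.trans_le hx.1
    have hN := hPlpos x hx
    have hpR0 : 0 < pR := by rw [hpR]; positivity
    have hqR0 : 0 < qR := by rw [hqR]; positivity
    simp only [hgα]
    positivity
  -- (3) Rolle ×3
  have hmem : ∀ x, x = x₁ ∨ x = x₂ ∨ x = x₃ ∨ x = x₄ → x ∈ ({x₁, x₂, x₃, x₄} : Set ℝ) := by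
    intro x h; simp only [Set.mem_insert_iff, Set.mem_singleton_iff]; tauto
  have ha1 : α x₁ = a := hαa x₁ ⟨le_rfl, by linarith⟩ (hzero x₁ (hmem x₁ (Or.inl rfl)))
  have ha2 : α x₂ = a := hαa x₂ ⟨h12.le, by linarith⟩ (hzero x₂ (hmem x₂ (Or.inr (Or.inl rfl))))
  have ha3 : α x₃ = a := hαa x₃ ⟨by linarith, h34.le⟩ (hzero x₃ (hmem x₃ (Or.inr (Or.inr (Or.inl rfl)))))
  have ha4 : α x₄ = a := hαa x₄ ⟨by linarith, le_rfl⟩ (hzero x₄ (hmem x₄ (Or.inr (Or.inr (Or.inr rfl)))))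
  have hcont : ∀ u v, x₁ ≤ u → v ≤ x₄ → ContinuousOn α (Set.Icc u v) := fun u v hu hv x hx => by
    obtain ⟨f', hf', _⟩ := hderα x ⟨hu.trans hx.1, hx.2.trans hv⟩
    exact hf'.continuousAt.continuousWithinAt
  have hcrit : ∀ u v, x₁ ≤ u → u < v → v ≤ x₄ → α u = α v → ∃ ξ, u < ξ ∧ ξ < v ∧ D ξ = 0 := by
    intro u v hu huv hv huv'
    obtain ⟨ξ, hξ, hξ'⟩ := exists_deriv_eq_zero huv (hcont u v hu hv) huv'
    have hξI : ξ ∈ Set.Icc x₁ x₄ := ⟨hu.trans hξ.1.le, hξ.2.le.trans hv⟩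
    obtain ⟨f', hf', ef'⟩ := hderα ξ hξI
    rw [hf'.deriv] at hξ'
    rw [hξ'] at ef'
    refine ⟨ξ, hξ.1, hξ.2, ?_⟩
    rcases mul_eq_zero.1 ef'.symm with h | h
    · exact absurd h (hgαpos ξ hξI).ne'
    · exact h
  obtain ⟨ξ₁, h1l, h1r, hD1⟩ := hcrit x₁ x₂ le_rfl h12 (by linarith) (ha1.trans ha2.symm)
  obtain ⟨ξ₂, h2l, h2r, hD2⟩ := hcrit x₂ x₃ h12.le h23 (by linarith) (ha2.trans ha3.symm)
  obtain ⟨ξ₃, h3l, h3r, hD3⟩ := hcrit x₃ x₄ (by linarith) h34 le_rfl (ha3.trans ha4.symm)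
  -- (4) three zeros of `D` inside `(x₁, x₄)`: excluded by hypothesis
  exact hD ξ₁ ξ₂ ξ₃ h1l (h1r.trans h2l) (h2r.trans h3l) h3r
    (by simpa only [hDdef] using hD1) (by simpa only [hDdef] using hD2) (by simpa only [hDdef] using hD3)

end ProductPlusOne

end Summit.ValiantsHypothesis.ValiantsHypothesis.Theorems.LacunarySymmetroidMatrixDescartes
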